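import Literature.NumberTheory.EllipticCurves.BurungaleTian2026.EtaSignedMainConjectureTensorQ
import Literature.NumberTheory.EllipticCurves.Kobayashi2003.EtaBranchLFunctionUniqueProofs
import Literature.NumberTheory.EllipticCurves.Kobayashi2003.EtaSignedSelmerDualExistsProofs
import HarnessLib

/-!
# Burungale–Tian 2026 Thm. 2.6 ∘ Kobayashi 2003 Thm. 7.4 for a CM curve, HYPOTHESIS-FREE forms: the
# even / odd `η`-main conjectures up to powers of `p`, and «main conjecture at `η` ⟺ `μ`-equality»,
# with the displayed uniqueness hypothesis `huniq` DISCHARGED (proofs only; no named fact; net debt 0)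

Topic `NumberTheory/EllipticCurves`, sub-directory `BurungaleTian2026` (namespace = path). Cell
`bsd-cm` (HOME `run/shared/lean/pub/bsd-cm/`), seat `bsd-cm-k8i-ty` g7 (literature-prover, typer
lane), rung K8-inert of `BirchSwinnertonDyer`, route `InertBadSignedBranches`, item
stmt-BirchSwinnertonDyer-19501 `PlusMCEtaK`. HONEST FRAMING (cell bsd-cm): the programme assembles
the Birch–Swinnerton-Dyer formula for analytic-rank `≤ 1` curves STRICTLY from published theorems and
TYPES the remainder; BSD is not proved by any of this; a closed item closes a rung leaf, never the
summit. THIS FILE: THEOREMS ONLY. Nothing about any curve is asserted beyond what follows from the two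
named facts displayed as hypotheses (`h26` = the composed [BT26 Thm. 2.6 ∘ Kob03 §5/7.1 ii)/proof of
7.4] fact `thm26_etaKatoSequences_charIdeal_upToP_of_cm`; `h22` = Kobayashi's Thm. 2.2 at `η`,
`thm22_etaSignedSelmerDual_finite_torsion`).

## What this file does

The sibling `EtaSignedMainConjectureTensorQ.lean` (§3–§5) proves, for a CM curve `V/ℚ` at an odd good
prime `p` with `a_p = 0` and the quadratic character `η` of `Gal(ℚ(μ_p)/ℚ)`:
(§3) Kobayashi's even / odd main conjectures at `η` UP TO POWERS OF `p`, in the `∀ L` form under a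
DISPLAYED hypothesis `huniq` («any two `L` with the interpolation property generate the same ideal»);
(§4/§5) «`D.charIdeal = (L)` ⟺ `μ(X(D)) = μ(Λ/(L))`», under the same `huniq`. The sibling
`Kobayashi2003/EtaBranchLFunctionUniqueProofs.lean` (this seat) PROVES `huniq` for both signs
(`IsQuadraticBranchPlusLFunction.span_singleton_eq`, `IsQuadraticBranchMinusLFunction.span_singleton_eq`:
[Kob03] Thm. 3.2's functions are determined up to `ℤ_pˣ` by (3.4)–(3.7)). This file substitutes the
proof for the hypothesis: the four statements below carry NO hypothesis beyond the frame of item 19501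
(`p ≠ 2`, `K₀ = ℚ(μ_p)`, `η` quadratic, `V` CM globally minimal good at `p` with `a_p = 0`, newform
`f`, period ratio `ϖ`, cyclotomic `κ, γ`), `V.HasCM`, and the two named facts `h26`, `h22`.
So, Literature-side and by name: **item 19501 `PlusMCEtaK` holds for `(V, p, η, Lp, D)` IF AND ONLY
IF `μ(X(D)) = μ(Λ/(Lp))`**, granted [BT26 Thm. 2.6] (read at `η`) and [Kob03 Thm. 2.2] — the exact
residual that [BT26] Rem. 2.7 leaves to «a finer analysis of [Kato §15]» (cell memo N26 §3 derives it
on paper; not print, not asserted).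

References: [BurungaleTian2026] A. Burungale, Y. Tian, Ann. of Math. 203 (2026), Thm. 2.6 and
Rem. 2.7 (p. 5); [Kobayashi2003] S. Kobayashi, Invent. Math. 152 (2003), Thm. 2.2 (p. 5), Thm. 3.2
with (3.4)–(3.7) (p. 7), §4 (p. 8), proof of Thm. 7.4 (p. 13); [Washington1997] §13.2 (`μ`).
-/

noncomputable section

open scoped Classical

open CongruenceSubgroup Polynomial WeierstrassCurve Field Literature.NumberTheory.EllipticCurves
  Literature.NumberTheory.EllipticCurves.ModularForms Literature.NumberTheory.GaloisRepresentations
  ZpExtension Literature.NumberTheory.EllipticCurves.Kobayashi2003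
  Literature.NumberTheory.EllipticCurves.IwasawaAlgebra

namespace Literature.NumberTheory.EllipticCurves.BurungaleTian2026

variable {p : ℕ} [Fact p.Prime]

/-- **Kobayashi's EVEN main conjecture at `η` for a CM curve, UP TO POWERS OF `p`, `∀ Lp` form,
hypothesis-free**: for every `Lp` with the interpolation property of `L_p⁺(V, η, X)` and every plus
datum `D`, `(p^b)·Char(X(D)) = (p^a)·(Lp)` for some `a b`. (= the sibling's
`evenEtaCharIdeal_eq_upToP_of_cm_of_unique` with `huniq` discharged by
`IsQuadraticBranchPlusLFunction.span_singleton_eq`.)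
[cite: BurungaleTian2026, Thm. 2.6 (p. 5)] [cite: Kobayashi2003, proof of Thm. 7.4 (p. 13), Thm. 3.2 and (3.4) (p. 7), Thm. 2.2 (p. 5)] -/
theorem evenEtaCharIdeal_eq_upToP_of_cm'
    (h26 : thm26_etaKatoSequences_charIdeal_upToP_of_cm)
    (h22 : thm22_etaSignedSelmerDual_finite_torsion)
    (K₀ : Type) [Field K₀] [NumberField K₀] [IsCyclotomicExtension {p} ℚ K₀]
    [(galRange (K := ℚ) K₀).Normal] (η : absoluteGaloisGroup ℚ →* ℤˣ)
    (hη : ∀ σ ∈ galRange (K := ℚ) K₀, η σ = 1) (hη1 : η ≠ 1)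
    (V : WeierstrassCurve ℚ) [V.IsElliptic] [V.IsGloballyMinimal] {N : ℕ} [NeZero N]
    {f : CuspForm (Gamma0 N) 2} (hp : p ≠ 2) (hCM : V.HasCM) (hgood : V.HasGoodReductionAtPrime p)
    (hap : V.frobeniusTrace p = 0) (hf : IsNewformOf V f) (ϖ : ℚ)
    (hϖ : if Even (p / 2) then (ϖ : ℝ) * V.realPeriodRat = plusPeriod f
      else (ϖ : ℝ) * V.imaginaryPeriodRat = minusPeriod f)
    (κ : ZpExtension ℚ p) (γ : absoluteGaloisGroup ℚ) (hκ : κ.IsCyclotomic)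
    (hγ : κ.IsTopGenerator γ) (hγK : γ ∈ galRange (K := ℚ) K₀) (hvar : IsCyclotomicVariable p γ)
    (Lp : IwasawaAlgebra p) (hLp : IsQuadraticBranchPlusLFunction f p ϖ Lp)
    (D : EtaSignedSelmerDualData V κ K₀ ℚ_[p] η γ 1) :
    ∃ a b : ℕ, Ideal.span {(p : IwasawaAlgebra p) ^ b} * D.charIdeal =
      Ideal.span {(p : IwasawaAlgebra p) ^ a} * Ideal.span {Lp} :=
  evenEtaCharIdeal_eq_upToP_of_cm_of_unique h26 h22 K₀ η hη hη1 V hp hCM hgood hap hf ϖ hϖ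
    (fun _ _ h₁ h₂ ↦ IsQuadraticBranchPlusLFunction.span_singleton_eq hp h₁ h₂)
    κ γ hκ hγ hγK hvar Lp hLp D

/-- **Item 19501 is the `μ`-equality, hypothesis-free (kernel).** For a CM curve in the frame of
item 19501 `PlusMCEtaK`, every `Lp` with the interpolation property of `L_p⁺(V, η, X)` and every plus
datum `D`: Kobayashi's even main conjecture at `η` — `D.charIdeal = (Lp)`, the conclusion of
`PlusMCEtaK` verbatim — holds IF AND ONLY IF `μ(X(D)) = μ(Λ/(Lp))`, granted only the two named facts
`h26` ([BT26] Thm. 2.6 read at `η`) and `h22` ([Kob03] Thm. 2.2 at `η`). (= the sibling's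
`evenEtaCharIdeal_eq_iff_muInvariant_eq_of_cm` with `huniq` discharged.)
[cite: BurungaleTian2026, Thm. 2.6 and Rem. 2.7 (p. 5)] [cite: Kobayashi2003, §4 (p. 8), proof of Thm. 7.4 (p. 13), Thm. 3.2 and (3.4) (p. 7), Thm. 2.2 (p. 5)]
[cite: Washington1997, §13.2] -/
theorem evenEtaCharIdeal_eq_iff_muInvariant_eq_of_cm'
    (h26 : thm26_etaKatoSequences_charIdeal_upToP_of_cm)
    (h22 : thm22_etaSignedSelmerDual_finite_torsion)
    (K₀ : Type) [Field K₀] [NumberField K₀] [IsCyclotomicExtension {p} ℚ K₀]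
    [(galRange (K := ℚ) K₀).Normal] (η : absoluteGaloisGroup ℚ →* ℤˣ)
    (hη : ∀ σ ∈ galRange (K := ℚ) K₀, η σ = 1) (hη1 : η ≠ 1)
    (V : WeierstrassCurve ℚ) [V.IsElliptic] [V.IsGloballyMinimal] {N : ℕ} [NeZero N]
    {f : CuspForm (Gamma0 N) 2} (hp : p ≠ 2) (hCM : V.HasCM) (hgood : V.HasGoodReductionAtPrime p)
    (hap : V.frobeniusTrace p = 0) (hf : IsNewformOf V f) (ϖ : ℚ)
    (hϖ : if Even (p / 2) then (ϖ : ℝ) * V.realPeriodRat = plusPeriod f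
      else (ϖ : ℝ) * V.imaginaryPeriodRat = minusPeriod f)
    (κ : ZpExtension ℚ p) (γ : absoluteGaloisGroup ℚ) (hκ : κ.IsCyclotomic)
    (hγ : κ.IsTopGenerator γ) (hγK : γ ∈ galRange (K := ℚ) K₀) (hvar : IsCyclotomicVariable p γ)
    (Lp : IwasawaAlgebra p) (hLp : IsQuadraticBranchPlusLFunction f p ϖ Lp)
    (D : EtaSignedSelmerDualData V κ K₀ ℚ_[p] η γ 1) :
    D.charIdeal = Ideal.span {Lp} ↔
      muInvariant p D.X = muInvariant p (IwasawaAlgebra p ⧸ Ideal.span {Lp}) :=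
  evenEtaCharIdeal_eq_iff_muInvariant_eq_of_cm h26 h22 K₀ η hη hη1 V hp hCM hgood hap hf ϖ hϖ
    (fun _ _ h₁ h₂ ↦ IsQuadraticBranchPlusLFunction.span_singleton_eq hp h₁ h₂)
    κ γ hκ hγ hγK hvar Lp hLp D

/-- **Kobayashi's ODD main conjecture at `η ≠ 1` for a CM curve, UP TO POWERS OF `p`, `∀ Lm` form,
hypothesis-free**: for every `Lm` with the interpolation property of `L_p⁻(V, η, X)`, every `L'` with
`Lm = X·L'` and every minus datum `D`, `(p^b)·Char(X(D)) = (p^a)·(L')` for some `a b`. (= the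
sibling's `oddEtaCharIdeal_eq_upToP_of_cm_of_unique` with `huniq` discharged by
`IsQuadraticBranchMinusLFunction.span_singleton_eq`.)
[cite: BurungaleTian2026, Thm. 2.6 (p. 5)] [cite: Kobayashi2003, §4 odd main conjecture (p. 8), proof of Thm. 7.4 (p. 13), Thm. 3.2 and (3.5), (3.7) (p. 7), Thm. 2.2 (p. 5)] -/
theorem oddEtaCharIdeal_eq_upToP_of_cm'
    (h26 : thm26_etaKatoSequences_charIdeal_upToP_of_cm)
    (h22 : thm22_etaSignedSelmerDual_finite_torsion)
    (K₀ : Type) [Field K₀] [NumberField K₀] [IsCyclotomicExtension {p} ℚ K₀]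
    [(galRange (K := ℚ) K₀).Normal] (η : absoluteGaloisGroup ℚ →* ℤˣ)
    (hη : ∀ σ ∈ galRange (K := ℚ) K₀, η σ = 1) (hη1 : η ≠ 1)
    (V : WeierstrassCurve ℚ) [V.IsElliptic] [V.IsGloballyMinimal] {N : ℕ} [NeZero N]
    {f : CuspForm (Gamma0 N) 2} (hp : p ≠ 2) (hCM : V.HasCM) (hgood : V.HasGoodReductionAtPrime p)
    (hap : V.frobeniusTrace p = 0) (hf : IsNewformOf V f) (ϖ : ℚ)
    (hϖ : if Even (p / 2) then (ϖ : ℝ) * V.realPeriodRat = plusPeriod f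
      else (ϖ : ℝ) * V.imaginaryPeriodRat = minusPeriod f)
    (κ : ZpExtension ℚ p) (γ : absoluteGaloisGroup ℚ) (hκ : κ.IsCyclotomic)
    (hγ : κ.IsTopGenerator γ) (hγK : γ ∈ galRange (K := ℚ) K₀) (hvar : IsCyclotomicVariable p γ)
    (Lm : IwasawaAlgebra p) (hLm : IsQuadraticBranchMinusLFunction f p ϖ Lm)
    (L' : IwasawaAlgebra p) (hL' : Lm = PowerSeries.X * L')
    (D : EtaSignedSelmerDualData V κ K₀ ℚ_[p] η γ (-1)) :
    ∃ a b : ℕ, Ideal.span {(p : IwasawaAlgebra p) ^ b} * D.charIdeal =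
      Ideal.span {(p : IwasawaAlgebra p) ^ a} * Ideal.span {L'} :=
  oddEtaCharIdeal_eq_upToP_of_cm_of_unique h26 h22 K₀ η hη hη1 V hp hCM hgood hap hf ϖ hϖ
    (fun _ _ h₁ h₂ ↦ IsQuadraticBranchMinusLFunction.span_singleton_eq hp h₁ h₂)
    κ γ hκ hγ hγK hvar Lm hLm L' hL' D

/-- **The odd main conjecture at `η ≠ 1` is the `μ`-equality, hypothesis-free (kernel).** For a CM
curve in the frame above, every `Lm` with the interpolation property of `L_p⁻(V, η, X)`, every `L'`
with `Lm = X·L'` and every minus datum `D`: «`Char(X⁻(E/K_∞)^η) = ((1/X)L⁻_p(E, η, X))`» ([Kob03] §4)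
in the tree's currency `D.charIdeal = (L')` holds IF AND ONLY IF `μ(X(D)) = μ(Λ/(L'))`, granted only
`h26` and `h22`. (= the sibling's `oddEtaCharIdeal_eq_iff_muInvariant_eq_of_cm` with `huniq`
discharged.)
[cite: BurungaleTian2026, Thm. 2.6 and Rem. 2.7 (p. 5)] [cite: Kobayashi2003, §4 (p. 8), proof of Thm. 7.4 (p. 13), Thm. 3.2 and (3.5), (3.7) (p. 7), Thm. 2.2 (p. 5)]
[cite: Washington1997, §13.2] -/
theorem oddEtaCharIdeal_eq_iff_muInvariant_eq_of_cm'
    (h26 : thm26_etaKatoSequences_charIdeal_upToP_of_cm)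
    (h22 : thm22_etaSignedSelmerDual_finite_torsion)
    (K₀ : Type) [Field K₀] [NumberField K₀] [IsCyclotomicExtension {p} ℚ K₀]
    [(galRange (K := ℚ) K₀).Normal] (η : absoluteGaloisGroup ℚ →* ℤˣ)
    (hη : ∀ σ ∈ galRange (K := ℚ) K₀, η σ = 1) (hη1 : η ≠ 1)
    (V : WeierstrassCurve ℚ) [V.IsElliptic] [V.IsGloballyMinimal] {N : ℕ} [NeZero N]
    {f : CuspForm (Gamma0 N) 2} (hp : p ≠ 2) (hCM : V.HasCM) (hgood : V.HasGoodReductionAtPrime p)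
    (hap : V.frobeniusTrace p = 0) (hf : IsNewformOf V f) (ϖ : ℚ)
    (hϖ : if Even (p / 2) then (ϖ : ℝ) * V.realPeriodRat = plusPeriod f
      else (ϖ : ℝ) * V.imaginaryPeriodRat = minusPeriod f)
    (κ : ZpExtension ℚ p) (γ : absoluteGaloisGroup ℚ) (hκ : κ.IsCyclotomic)
    (hγ : κ.IsTopGenerator γ) (hγK : γ ∈ galRange (K := ℚ) K₀) (hvar : IsCyclotomicVariable p γ)
    (Lm : IwasawaAlgebra p) (hLm : IsQuadraticBranchMinusLFunction f p ϖ Lm)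
    (L' : IwasawaAlgebra p) (hL' : Lm = PowerSeries.X * L')
    (D : EtaSignedSelmerDualData V κ K₀ ℚ_[p] η γ (-1)) :
    D.charIdeal = Ideal.span {L'} ↔
      muInvariant p D.X = muInvariant p (IwasawaAlgebra p ⧸ Ideal.span {L'}) :=
  oddEtaCharIdeal_eq_iff_muInvariant_eq_of_cm h26 h22 K₀ η hη hη1 V hp hCM hgood hap hf ϖ hϖ
    (fun _ _ h₁ h₂ ↦ IsQuadraticBranchMinusLFunction.span_singleton_eq hp h₁ h₂)
    κ γ hκ hγ hγK hvar Lm hLm L' hL' D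

/-- **The two signs together, hypothesis-free: for a CM `V` in the frame of item 19501, granted `h26`
and `h22`, the even main conjecture at `η` holds for every `(Lp, D⁺)` and the odd one for every
`(Lm = X·L', D⁻)` IF AND ONLY IF the corresponding `μ`-invariants agree on both sides** — the
Literature-side normal form of what remains of 19501 (and of its odd companion, read by the K8-inert
route's exact-reading chain through [Kob03] Thm. 7.4) after [BT26] Thm. 2.6.
[cite: BurungaleTian2026, Thm. 2.6 and Rem. 2.7 (p. 5)] [cite: Kobayashi2003, §4 (p. 8), Thm. 7.4 (p. 13)] -/
theorem etaSignedMC_iff_muInvariant_eq_of_cm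
    (h26 : thm26_etaKatoSequences_charIdeal_upToP_of_cm)
    (h22 : thm22_etaSignedSelmerDual_finite_torsion)
    (K₀ : Type) [Field K₀] [NumberField K₀] [IsCyclotomicExtension {p} ℚ K₀]
    [(galRange (K := ℚ) K₀).Normal] (η : absoluteGaloisGroup ℚ →* ℤˣ)
    (hη : ∀ σ ∈ galRange (K := ℚ) K₀, η σ = 1) (hη1 : η ≠ 1)
    (V : WeierstrassCurve ℚ) [V.IsElliptic] [V.IsGloballyMinimal] {N : ℕ} [NeZero N]
    {f : CuspForm (Gamma0 N) 2} (hp : p ≠ 2) (hCM : V.HasCM) (hgood : V.HasGoodReductionAtPrime p)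
    (hap : V.frobeniusTrace p = 0) (hf : IsNewformOf V f) (ϖ : ℚ)
    (hϖ : if Even (p / 2) then (ϖ : ℝ) * V.realPeriodRat = plusPeriod f
      else (ϖ : ℝ) * V.imaginaryPeriodRat = minusPeriod f)
    (κ : ZpExtension ℚ p) (γ : absoluteGaloisGroup ℚ) (hκ : κ.IsCyclotomic)
    (hγ : κ.IsTopGenerator γ) (hγK : γ ∈ galRange (K := ℚ) K₀) (hvar : IsCyclotomicVariable p γ) :
    ((∀ (Lp : IwasawaAlgebra p), IsQuadraticBranchPlusLFunction f p ϖ Lp →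
        ∀ D : EtaSignedSelmerDualData V κ K₀ ℚ_[p] η γ 1, D.charIdeal = Ideal.span {Lp}) ↔
      (∀ (Lp : IwasawaAlgebra p), IsQuadraticBranchPlusLFunction f p ϖ Lp →
        ∀ D : EtaSignedSelmerDualData V κ K₀ ℚ_[p] η γ 1,
          muInvariant p D.X = muInvariant p (IwasawaAlgebra p ⧸ Ideal.span {Lp}))) ∧
    ((∀ (Lm : IwasawaAlgebra p), IsQuadraticBranchMinusLFunction f p ϖ Lm →
        ∀ (L' : IwasawaAlgebra p), Lm = PowerSeries.X * L' →
        ∀ D : EtaSignedSelmerDualData V κ K₀ ℚ_[p] η γ (-1), D.charIdeal = Ideal.span {L'}) ↔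
      (∀ (Lm : IwasawaAlgebra p), IsQuadraticBranchMinusLFunction f p ϖ Lm →
        ∀ (L' : IwasawaAlgebra p), Lm = PowerSeries.X * L' →
        ∀ D : EtaSignedSelmerDualData V κ K₀ ℚ_[p] η γ (-1),
          muInvariant p D.X = muInvariant p (IwasawaAlgebra p ⧸ Ideal.span {L'}))) := by
  refine ⟨forall₃_congr fun Lp hLp D ↦ ?_, forall₅_congr fun Lm hLm L' hL' D ↦ ?_⟩
  · exact evenEtaCharIdeal_eq_iff_muInvariant_eq_of_cm' h26 h22 K₀ η hη hη1 V hp hCM hgood hap hf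
      ϖ hϖ κ γ hκ hγ hγK hvar Lp hLp D
  · exact oddEtaCharIdeal_eq_iff_muInvariant_eq_of_cm' h26 h22 K₀ η hη hη1 V hp hCM hgood hap hf
      ϖ hϖ κ γ hκ hγ hγK hvar Lm hLm L' hL' D

/-! ## §3 (appended, proofs only; seat bsd-cm-k8i-ty g8, `--supports` item 19865 `PlusMCEtaKMuPart`)
## Sign symmetry: the `μ`-defect of Kobayashi's `η`-main conjectures is the same for both signs

After the planner's by-name split of item 19501 (bsd-cm-plan g20, D119) the residual of the K8-inert
`η`-node is item 19865 `PlusMCEtaKMuPart`: «`μ(X⁺(V/K_∞)^η) = μ(Λ/(L_p⁺(V, η, X)))`» (conclusion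
`muInvariant p D.X = muInvariant p (Λ ⧸ (Lp))` on the Summits twin of `EtaSignedSelmerDualData`), open
in print ([BT26] Rem. 2.7; Rem. 2.2 «still open for `p` non-split»). This section proves, from `h26`
and `h22` ALONE (the two facts of 19867 `PublishedInputsEtaUpToP`; NOT the Thm. 7.4 fact `h74`):
(i) the `μ`-DEFECT `μ(X(D)) − μ(Λ/(L))` is the SAME integer for the even pair `(Lp, D⁺)` and the odd
pair `(L' = L_p⁻/X, D⁻)` — both equal `μ(B) − μ(A)` for the common ends of the two four-term
sequences of [Kob03]'s proof of Thm. 7.4 (the `μ`-part of Kato's main conjecture at `η`);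
(ii) hence the even `μ`-part (19865) and the odd `μ`-part are equivalent, pointwise and as
`∀`-statements; (iii) [Kob03] Thm. 7.4 (ii) ⟺ (iii) at `η` for CM `V` follows from [BT26]'s package.
Tools: `span_singleton_mul_charIdeal_eq_of_fourTermExact` (sibling §1), `μ(M) = μ(Λ/(g))` for
`char(M) = (g)` (sibling §4), additivity of the local length at `(p)` on cyclic modules
(`Module.lengthAt_quotient_span_singleton_mul`). THEOREMS ONLY; nothing new is asserted; no fact.
-/

/-- `Λ/(L)` is a torsion `Λ`-module for `L ≠ 0`. [folklore] -/
private theorem isTorsion_quotient_span_singleton' {L : IwasawaAlgebra p} (hL : L ≠ 0) :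
    Module.IsTorsion (IwasawaAlgebra p) (IwasawaAlgebra p ⧸ Ideal.span {L}) := by
  intro x
  refine ⟨⟨L, mem_nonZeroDivisors_of_ne_zero hL⟩, ?_⟩
  obtain ⟨r, rfl⟩ := Ideal.Quotient.mk_surjective x
  change L • Ideal.Quotient.mk (Ideal.span {L}) r = 0
  rw [← Ideal.Quotient.mk_eq_mk, ← Submodule.Quotient.mk_smul, Submodule.Quotient.mk_eq_zero,
    smul_eq_mul]
  exact Ideal.mul_mem_right r _ (Ideal.mem_span_singleton_self L)

/-- **`μ(Λ/(x·y)) = μ(Λ/(x)) + μ(Λ/(y))`** for `x, y ≠ 0`: `μ` of a cyclic torsion module is the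
local length at the height-one prime `(p)`, additive along `0 → Λ/(y) → Λ/(xy) → Λ/(x) → 0`.
[cite: Washington1997, §13.2] -/
theorem muInvariant_quotient_mul {x y : IwasawaAlgebra p} (hx : x ≠ 0) (hy : y ≠ 0) :
    muInvariant p (IwasawaAlgebra p ⧸ Ideal.span {x * y}) =
      muInvariant p (IwasawaAlgebra p ⧸ Ideal.span {x}) +
        muInvariant p (IwasawaAlgebra p ⧸ Ideal.span {y}) := by
  let 𝔭 : PrimeSpectrum (IwasawaAlgebra p) := ⟨augIdealP p, isPrime_augIdealP_holds p⟩
  have hx' := lengthAt_ne_top_of_isTorsion p _ (isTorsion_quotient_span_singleton' hx) 𝔭 rfl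
  have hy' := lengthAt_ne_top_of_isTorsion p _ (isTorsion_quotient_span_singleton' hy) 𝔭 rfl
  rw [muInvariant_eq_toNat_lengthAt p _ 𝔭 rfl, muInvariant_eq_toNat_lengthAt p _ 𝔭 rfl,
    muInvariant_eq_toNat_lengthAt p _ 𝔭 rfl, Module.lengthAt_quotient_span_singleton_mul y hx 𝔭,
    ENat.toNat_add hx' hy']

/-- Equal principal ideals have quotients with the same `μ`. [folklore] -/
private theorem muInvariant_quotient_congr {x y : IwasawaAlgebra p}
    (h : Ideal.span ({x} : Set (IwasawaAlgebra p)) = Ideal.span {y}) :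
    muInvariant p (IwasawaAlgebra p ⧸ Ideal.span {x}) =
      muInvariant p (IwasawaAlgebra p ⧸ Ideal.span {y}) := by
  let 𝔭 : PrimeSpectrum (IwasawaAlgebra p) := ⟨augIdealP p, isPrime_augIdealP_holds p⟩
  rw [muInvariant_eq_toNat_lengthAt p _ 𝔭 rfl, muInvariant_eq_toNat_lengthAt p _ 𝔭 rfl,
    Module.lengthAt_eq_of_linearEquiv (Submodule.quotEquivOfEq _ _ h) 𝔭]

section MuDefectAlgebra

variable {A X B : Type} [AddCommGroup A] [Module (IwasawaAlgebra p) A] [AddCommGroup X]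
  [Module (IwasawaAlgebra p) X] [AddCommGroup B] [Module (IwasawaAlgebra p) B]

/-- **The `μ`-bookkeeping of `0 → A → Λ/(L) → X → B → 0`** (`A` finitely generated torsion, `B`
finitely generated torsion, `X` torsion): `μ(Λ/(L)) + μ(B) = μ(A) + μ(X)` — the `μ`-shadow of
`(L)·char(B) = char(A)·char(X)` (`span_singleton_mul_charIdeal_eq_of_fourTermExact`).
[cite: Kobayashi2003, proof of Thm. 7.4 (p. 13)] [cite: Washington1997, §13.2] -/
theorem muInvariant_add_eq_of_fourTermExact [Module.Finite (IwasawaAlgebra p) A]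
    (hA : Module.IsTorsion (IwasawaAlgebra p) A) [Module.Finite (IwasawaAlgebra p) B]
    (hB : Module.IsTorsion (IwasawaAlgebra p) B) (hX : Module.IsTorsion (IwasawaAlgebra p) X)
    {L : IwasawaAlgebra p} (f : A →ₗ[IwasawaAlgebra p] IwasawaAlgebra p ⧸ Ideal.span {L})
    (g : (IwasawaAlgebra p ⧸ Ideal.span {L}) →ₗ[IwasawaAlgebra p] X)
    (h : X →ₗ[IwasawaAlgebra p] B) (hf : Function.Injective f) (hfg : Function.Exact f g)
    (hgh : Function.Exact g h) (hh : Function.Surjective h) :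
    muInvariant p (IwasawaAlgebra p ⧸ Ideal.span {L}) + muInvariant p B =
      muInvariant p A + muInvariant p X := by
  have hL : L ≠ 0 := ne_zero_of_fourTermExact_of_isTorsion hA hX f g hfg
  have h4 := span_singleton_mul_charIdeal_eq_of_fourTermExact hB hL f g h hf hfg hgh hh
  haveI : Module.Finite (IwasawaAlgebra p) X := by
    have h2 : Function.Exact (LinearMap.range g).subtype h := by
      rw [LinearMap.exact_iff, hgh.linearMap_ker_eq, Submodule.range_subtype]
    exact Module.Finite.of_exact h2 hh
  obtain ⟨gA, hgA0, hgA⟩ := exists_charIdeal_eq_span_ne_zero (p := p) A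
  obtain ⟨gB, hgB0, hgB⟩ := exists_charIdeal_eq_span_ne_zero (p := p) B
  obtain ⟨gX, hgX0, hgX⟩ := exists_charIdeal_eq_span_ne_zero (p := p) X
  rw [muInvariant_eq_muInvariant_quotient_of_charIdeal_eq_span A hA hgA,
    muInvariant_eq_muInvariant_quotient_of_charIdeal_eq_span B hB hgB,
    muInvariant_eq_muInvariant_quotient_of_charIdeal_eq_span X hX hgX,
    ← muInvariant_quotient_mul hL hgB0, ← muInvariant_quotient_mul hgA0 hgX0]
  apply muInvariant_quotient_congr
  rw [← Ideal.span_singleton_mul_span_singleton, ← Ideal.span_singleton_mul_span_singleton, ← hgB,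
    ← hgA, ← hgX, h4]

end MuDefectAlgebra

/-- **Sign-independence of the `μ`-defect (pointwise; kernel).** For a CM curve `V/ℚ` in the frame
of item 19501 / 19865 (`p ≠ 2`, `K₀ = ℚ(μ_p)`, `η` the quadratic character of `Gal(ℚ(μ_p)/ℚ)`, `V`
globally minimal, good at `p` with `a_p = 0`, newform `f`, period ratio `ϖ`, cyclotomic `κ, γ`),
granted ONLY the two named facts `h26` ([BT26] Thm. 2.6 read at `η`, composed) and `h22` ([Kob03]
Thm. 2.2 at `η`): for EVERY `Lp` with the interpolation property of `L_p⁺(V, η, X)`, every plus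
datum `D⁺`, every `Lm` with the interpolation property of `L_p⁻(V, η, X)`, every `L'` with
`Lm = X·L'` and every minus datum `D⁻`,
`μ(X(D⁺)) + μ(Λ/(L')) = μ(X(D⁻)) + μ(Λ/(Lp))`, i.e. the `μ`-DEFECTS `μ(X(D⁺)) − μ(Λ/(Lp))` and
`μ(X(D⁻)) − μ(Λ/(L'))` of Kobayashi's even and odd main conjectures at `η` COINCIDE. Mechanism
([Kob03] proof of Thm. 7.4, p. 13, read through `μ`): both four-term `η`-sequences of the package
have the SAME ends `A` («`𝐇¹(T)^η/Z(T)^η`») and `B` («`X⁰(V/K_∞)^η`»), so both defects equal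
`μ(B) − μ(A)` — the `μ`-part of Kato's main conjecture at `η`, the object [BT26] Rem. 2.7 defers;
the ideals `(Lp)`, `(L')` are choice-free (`IsQuadraticBranchPlusLFunction.span_singleton_eq`,
`IsQuadraticBranchMinusLFunction.span_singleton_div_X_eq`). Nothing is asserted about the common
value. [cite: BurungaleTian2026, Thm. 2.6 and Rem. 2.7 (p. 5)]
[cite: Kobayashi2003, proof of Thm. 7.4 (p. 13), §4 (p. 8), Thm. 3.2 and (3.4)–(3.7) (p. 7), Thm. 2.2 (p. 5)]
[cite: Washington1997, §13.2] -/
theorem muInvariant_even_add_eq_odd_add_of_cm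
    (h26 : thm26_etaKatoSequences_charIdeal_upToP_of_cm)
    (h22 : thm22_etaSignedSelmerDual_finite_torsion)
    (K₀ : Type) [Field K₀] [NumberField K₀] [IsCyclotomicExtension {p} ℚ K₀]
    [(galRange (K := ℚ) K₀).Normal] (η : absoluteGaloisGroup ℚ →* ℤˣ)
    (hη : ∀ σ ∈ galRange (K := ℚ) K₀, η σ = 1) (hη1 : η ≠ 1)
    (V : WeierstrassCurve ℚ) [V.IsElliptic] [V.IsGloballyMinimal] {N : ℕ} [NeZero N]
    {f : CuspForm (Gamma0 N) 2} (hp : p ≠ 2) (hCM : V.HasCM) (hgood : V.HasGoodReductionAtPrime p)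
    (hap : V.frobeniusTrace p = 0) (hf : IsNewformOf V f) (ϖ : ℚ)
    (hϖ : if Even (p / 2) then (ϖ : ℝ) * V.realPeriodRat = plusPeriod f
      else (ϖ : ℝ) * V.imaginaryPeriodRat = minusPeriod f)
    (κ : ZpExtension ℚ p) (γ : absoluteGaloisGroup ℚ) (hκ : κ.IsCyclotomic)
    (hγ : κ.IsTopGenerator γ) (hγK : γ ∈ galRange (K := ℚ) K₀) (hvar : IsCyclotomicVariable p γ)
    (Lp : IwasawaAlgebra p) (hLp : IsQuadraticBranchPlusLFunction f p ϖ Lp)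
    (Dp : EtaSignedSelmerDualData V κ K₀ ℚ_[p] η γ 1)
    (Lm : IwasawaAlgebra p) (hLm : IsQuadraticBranchMinusLFunction f p ϖ Lm)
    (L' : IwasawaAlgebra p) (hL' : Lm = PowerSeries.X * L')
    (Dm : EtaSignedSelmerDualData V κ K₀ ℚ_[p] η γ (-1)) :
    muInvariant p Dp.X + muInvariant p (IwasawaAlgebra p ⧸ Ideal.span {L'}) =
      muInvariant p Dm.X + muInvariant p (IwasawaAlgebra p ⧸ Ideal.span {Lp}) := by
  obtain ⟨A, B, _, _, _, _, ⟨hAfin, hAtors⟩, ⟨hBfin, hBtors⟩, -, ⟨Lp₀, hLp₀, hSp⟩, ⟨Lm₀, hLm₀, hSm⟩⟩ :=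
    h26 p K₀ η hη hη1 V hp hCM hgood hap hf ϖ hϖ κ γ hκ hγ hγK hvar
  obtain ⟨L'₀, hL'₀⟩ := hLm₀.exists_eq_X_mul
  obtain ⟨ip, jp, kp, hip, hijp, hjkp, hkp⟩ := hSp Dp
  obtain ⟨im, jm, km, him, hijm, hjkm, hkm⟩ := hSm Dm L'₀ hL'₀
  have hXp : Module.IsTorsion (IwasawaAlgebra p) Dp.X :=
    (h22 p K₀ η hη V hp hgood hap κ γ hκ hγ hγK 1 Dp).2
  have hXm : Module.IsTorsion (IwasawaAlgebra p) Dm.X :=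
    (h22 p K₀ η hη V hp hgood hap κ γ hκ hγ hγK (-1) Dm).2
  haveI := hAfin
  haveI := hBfin
  have ep := muInvariant_add_eq_of_fourTermExact hAtors hBtors hXp ip jp kp hip hijp hjkp hkp
  have em := muInvariant_add_eq_of_fourTermExact hAtors hBtors hXm im jm km him hijm hjkm hkm
  have e1 : muInvariant p (IwasawaAlgebra p ⧸ Ideal.span {Lp}) =
      muInvariant p (IwasawaAlgebra p ⧸ Ideal.span {Lp₀}) :=
    muInvariant_quotient_congr (IsQuadraticBranchPlusLFunction.span_singleton_eq hp hLp hLp₀)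
  have e2 : muInvariant p (IwasawaAlgebra p ⧸ Ideal.span {L'}) =
      muInvariant p (IwasawaAlgebra p ⧸ Ideal.span {L'₀}) :=
    muInvariant_quotient_congr
      (IsQuadraticBranchMinusLFunction.span_singleton_div_X_eq hp hLm hLm₀ hL' hL'₀)
  rw [e1, e2]
  omega

/-- **The even `μ`-part holds at `(Lp, D⁺)` iff the odd `μ`-part holds at `(L', D⁻)` (pointwise;
kernel)**: `μ(X(D⁺)) = μ(Λ/(Lp)) ⟺ μ(X(D⁻)) = μ(Λ/(L'))` for a CM `V`, granted `h26` and `h22`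
only — the conclusion of the residual item 19865 `PlusMCEtaKMuPart` (Literature currency) and its
odd-side companion are ONE statement. [cite: BurungaleTian2026, Thm. 2.6 and Rem. 2.7 (p. 5)]
[cite: Kobayashi2003, proof of Thm. 7.4 (p. 13), §4 (p. 8)] [cite: Washington1997, §13.2] -/
theorem evenEtaMuInvariant_eq_iff_oddEtaMuInvariant_eq_of_cm
    (h26 : thm26_etaKatoSequences_charIdeal_upToP_of_cm)
    (h22 : thm22_etaSignedSelmerDual_finite_torsion)
    (K₀ : Type) [Field K₀] [NumberField K₀] [IsCyclotomicExtension {p} ℚ K₀]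
    [(galRange (K := ℚ) K₀).Normal] (η : absoluteGaloisGroup ℚ →* ℤˣ)
    (hη : ∀ σ ∈ galRange (K := ℚ) K₀, η σ = 1) (hη1 : η ≠ 1)
    (V : WeierstrassCurve ℚ) [V.IsElliptic] [V.IsGloballyMinimal] {N : ℕ} [NeZero N]
    {f : CuspForm (Gamma0 N) 2} (hp : p ≠ 2) (hCM : V.HasCM) (hgood : V.HasGoodReductionAtPrime p)
    (hap : V.frobeniusTrace p = 0) (hf : IsNewformOf V f) (ϖ : ℚ)
    (hϖ : if Even (p / 2) then (ϖ : ℝ) * V.realPeriodRat = plusPeriod f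
      else (ϖ : ℝ) * V.imaginaryPeriodRat = minusPeriod f)
    (κ : ZpExtension ℚ p) (γ : absoluteGaloisGroup ℚ) (hκ : κ.IsCyclotomic)
    (hγ : κ.IsTopGenerator γ) (hγK : γ ∈ galRange (K := ℚ) K₀) (hvar : IsCyclotomicVariable p γ)
    (Lp : IwasawaAlgebra p) (hLp : IsQuadraticBranchPlusLFunction f p ϖ Lp)
    (Dp : EtaSignedSelmerDualData V κ K₀ ℚ_[p] η γ 1)
    (Lm : IwasawaAlgebra p) (hLm : IsQuadraticBranchMinusLFunction f p ϖ Lm)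
    (L' : IwasawaAlgebra p) (hL' : Lm = PowerSeries.X * L')
    (Dm : EtaSignedSelmerDualData V κ K₀ ℚ_[p] η γ (-1)) :
    muInvariant p Dp.X = muInvariant p (IwasawaAlgebra p ⧸ Ideal.span {Lp}) ↔
      muInvariant p Dm.X = muInvariant p (IwasawaAlgebra p ⧸ Ideal.span {L'}) := by
  have e := muInvariant_even_add_eq_odd_add_of_cm h26 h22 K₀ η hη hη1 V hp hCM hgood hap hf ϖ hϖ
    κ γ hκ hγ hγK hvar Lp hLp Dp Lm hLm L' hL' Dm
  omega

/-- **Kobayashi's even main conjecture at `η` for `(Lp, D⁺)` iff the odd one for `(L', D⁻)`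
(pointwise; kernel)** — `Char X(D⁺) = (Lp) ⟺ Char X(D⁻) = (L')` for a CM `V`, granted `h26` and
`h22` only: [Kob03] Thm. 7.4 (ii) ⟺ (iii) at the quadratic `η`, CM case, obtained here from
[BT26]'s package (the sibling `μ`-criteria + the sign-independence of the `μ`-defect). The tree's
named fact `Kobayashi2003.thm74_etaEvenMC_iff_etaOddMC` (all `V` with `a_p = 0`) is NOT used; for CM
curves its content at `η` is thus implied by `h26 ∧ h22` (cf. the Summits-side
`Thm74Skeleton.thm74_etaEvenMC_iff_etaOddMC_of_etaExactSequencesFact`, all `V`, from the sequences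
fact). [cite: Kobayashi2003, Thm. 7.4 (p. 13), §4 (p. 8)] [cite: BurungaleTian2026, Thm. 2.6 (p. 5)] -/
theorem evenEtaCharIdeal_eq_iff_oddEtaCharIdeal_eq_of_cm
    (h26 : thm26_etaKatoSequences_charIdeal_upToP_of_cm)
    (h22 : thm22_etaSignedSelmerDual_finite_torsion)
    (K₀ : Type) [Field K₀] [NumberField K₀] [IsCyclotomicExtension {p} ℚ K₀]
    [(galRange (K := ℚ) K₀).Normal] (η : absoluteGaloisGroup ℚ →* ℤˣ)
    (hη : ∀ σ ∈ galRange (K := ℚ) K₀, η σ = 1) (hη1 : η ≠ 1)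
    (V : WeierstrassCurve ℚ) [V.IsElliptic] [V.IsGloballyMinimal] {N : ℕ} [NeZero N]
    {f : CuspForm (Gamma0 N) 2} (hp : p ≠ 2) (hCM : V.HasCM) (hgood : V.HasGoodReductionAtPrime p)
    (hap : V.frobeniusTrace p = 0) (hf : IsNewformOf V f) (ϖ : ℚ)
    (hϖ : if Even (p / 2) then (ϖ : ℝ) * V.realPeriodRat = plusPeriod f
      else (ϖ : ℝ) * V.imaginaryPeriodRat = minusPeriod f)
    (κ : ZpExtension ℚ p) (γ : absoluteGaloisGroup ℚ) (hκ : κ.IsCyclotomic)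
    (hγ : κ.IsTopGenerator γ) (hγK : γ ∈ galRange (K := ℚ) K₀) (hvar : IsCyclotomicVariable p γ)
    (Lp : IwasawaAlgebra p) (hLp : IsQuadraticBranchPlusLFunction f p ϖ Lp)
    (Dp : EtaSignedSelmerDualData V κ K₀ ℚ_[p] η γ 1)
    (Lm : IwasawaAlgebra p) (hLm : IsQuadraticBranchMinusLFunction f p ϖ Lm)
    (L' : IwasawaAlgebra p) (hL' : Lm = PowerSeries.X * L')
    (Dm : EtaSignedSelmerDualData V κ K₀ ℚ_[p] η γ (-1)) :
    Dp.charIdeal = Ideal.span {Lp} ↔ Dm.charIdeal = Ideal.span {L'} := by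
  rw [evenEtaCharIdeal_eq_iff_muInvariant_eq_of_cm' h26 h22 K₀ η hη hη1 V hp hCM hgood hap hf ϖ hϖ
      κ γ hκ hγ hγK hvar Lp hLp Dp,
    oddEtaCharIdeal_eq_iff_muInvariant_eq_of_cm' h26 h22 K₀ η hη hη1 V hp hCM hgood hap hf ϖ hϖ
      κ γ hκ hγ hγK hvar Lm hLm L' hL' Dm]
  exact evenEtaMuInvariant_eq_iff_oddEtaMuInvariant_eq_of_cm h26 h22 K₀ η hη hη1 V hp hCM hgood
    hap hf ϖ hϖ κ γ hκ hγ hγK hvar Lp hLp Dp Lm hLm L' hL' Dm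

/-- **The even `μ`-part (`∀ (Lp, D⁺)`, the shape of item 19865 `PlusMCEtaKMuPart`) iff the odd
`μ`-part (`∀ (Lm = X·L', D⁻)`)**, for a CM `V`, granted `h26` and `h22` only. The two data types are
DISPLAYED non-empty (`hDp`, `hDm`): true — Summits-side theorem
`Additive.nonempty_etaSignedSelmerDualData_cyclotomic` composed with the `rfl` transport
`PrintReadingsOfLiterature.toLiterature` — but not importable here (a Literature file cannot import
`Summits`); a plus / minus function exists by the package itself. So the K8-inert route's odd-side
readings carry NO second `μ`-residual: 19865 is the whole `μ`-part at `η`, both signs.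
[cite: BurungaleTian2026, Thm. 2.6 and Rem. 2.7 (p. 5)] [cite: Kobayashi2003, §4 (p. 8), proof of Thm. 7.4 (p. 13), (3.7) (p. 7)]
[cite: Washington1997, §13.2] -/
theorem evenEtaMuPart_iff_oddEtaMuPart_of_cm
    (h26 : thm26_etaKatoSequences_charIdeal_upToP_of_cm)
    (h22 : thm22_etaSignedSelmerDual_finite_torsion)
    (K₀ : Type) [Field K₀] [NumberField K₀] [IsCyclotomicExtension {p} ℚ K₀]
    [(galRange (K := ℚ) K₀).Normal] (η : absoluteGaloisGroup ℚ →* ℤˣ)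
    (hη : ∀ σ ∈ galRange (K := ℚ) K₀, η σ = 1) (hη1 : η ≠ 1)
    (V : WeierstrassCurve ℚ) [V.IsElliptic] [V.IsGloballyMinimal] {N : ℕ} [NeZero N]
    {f : CuspForm (Gamma0 N) 2} (hp : p ≠ 2) (hCM : V.HasCM) (hgood : V.HasGoodReductionAtPrime p)
    (hap : V.frobeniusTrace p = 0) (hf : IsNewformOf V f) (ϖ : ℚ)
    (hϖ : if Even (p / 2) then (ϖ : ℝ) * V.realPeriodRat = plusPeriod f
      else (ϖ : ℝ) * V.imaginaryPeriodRat = minusPeriod f)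
    (κ : ZpExtension ℚ p) (γ : absoluteGaloisGroup ℚ) (hκ : κ.IsCyclotomic)
    (hγ : κ.IsTopGenerator γ) (hγK : γ ∈ galRange (K := ℚ) K₀) (hvar : IsCyclotomicVariable p γ)
    (hDp : Nonempty (EtaSignedSelmerDualData V κ K₀ ℚ_[p] η γ 1))
    (hDm : Nonempty (EtaSignedSelmerDualData V κ K₀ ℚ_[p] η γ (-1))) :
    (∀ (Lp : IwasawaAlgebra p), IsQuadraticBranchPlusLFunction f p ϖ Lp →
        ∀ D : EtaSignedSelmerDualData V κ K₀ ℚ_[p] η γ 1,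
          muInvariant p D.X = muInvariant p (IwasawaAlgebra p ⧸ Ideal.span {Lp})) ↔
      (∀ (Lm : IwasawaAlgebra p), IsQuadraticBranchMinusLFunction f p ϖ Lm →
        ∀ (L' : IwasawaAlgebra p), Lm = PowerSeries.X * L' →
        ∀ D : EtaSignedSelmerDualData V κ K₀ ℚ_[p] η γ (-1),
          muInvariant p D.X = muInvariant p (IwasawaAlgebra p ⧸ Ideal.span {L'})) := by
  obtain ⟨Dp⟩ := hDp
  obtain ⟨Dm⟩ := hDm
  obtain ⟨A, B, _, _, _, _, -, -, -, ⟨Lp₀, hLp₀, -⟩, ⟨Lm₀, hLm₀, -⟩⟩ :=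
    h26 p K₀ η hη hη1 V hp hCM hgood hap hf ϖ hϖ κ γ hκ hγ hγK hvar
  obtain ⟨L'₀, hL'₀⟩ := hLm₀.exists_eq_X_mul
  constructor
  · intro h Lm hLm L' hL' D
    have e := muInvariant_even_add_eq_odd_add_of_cm h26 h22 K₀ η hη hη1 V hp hCM hgood hap hf ϖ hϖ
      κ γ hκ hγ hγK hvar Lp₀ hLp₀ Dp Lm hLm L' hL' D
    have := h Lp₀ hLp₀ Dp
    omega
  · intro h Lp hLp D
    have e := muInvariant_even_add_eq_odd_add_of_cm h26 h22 K₀ η hη hη1 V hp hCM hgood hap hf ϖ hϖ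
      κ γ hκ hγ hγK hvar Lp hLp D Lm₀ hLm₀ L'₀ hL'₀ Dm
    have := h Lm₀ hLm₀ L'₀ hL'₀ Dm
    omega

/-- **[Kob03] Thm. 7.4 (ii) ⟺ (iii) at the quadratic `η` for a CM curve, `∀` forms, from [BT26]'s
package**: the even main conjecture at `η` holds for every `(Lp, D⁺)` iff the odd one holds for every
`(Lm = X·L', D⁻)`, granted `h26` and `h22` only (data displayed non-empty as above; no use of the
named fact `thm74_etaEvenMC_iff_etaOddMC`). [cite: Kobayashi2003, Thm. 7.4 (p. 13), §4 (p. 8)]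
[cite: BurungaleTian2026, Thm. 2.6 (p. 5)] -/
theorem etaEvenMC_iff_etaOddMC_of_cm
    (h26 : thm26_etaKatoSequences_charIdeal_upToP_of_cm)
    (h22 : thm22_etaSignedSelmerDual_finite_torsion)
    (K₀ : Type) [Field K₀] [NumberField K₀] [IsCyclotomicExtension {p} ℚ K₀]
    [(galRange (K := ℚ) K₀).Normal] (η : absoluteGaloisGroup ℚ →* ℤˣ)
    (hη : ∀ σ ∈ galRange (K := ℚ) K₀, η σ = 1) (hη1 : η ≠ 1)
    (V : WeierstrassCurve ℚ) [V.IsElliptic] [V.IsGloballyMinimal] {N : ℕ} [NeZero N]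
    {f : CuspForm (Gamma0 N) 2} (hp : p ≠ 2) (hCM : V.HasCM) (hgood : V.HasGoodReductionAtPrime p)
    (hap : V.frobeniusTrace p = 0) (hf : IsNewformOf V f) (ϖ : ℚ)
    (hϖ : if Even (p / 2) then (ϖ : ℝ) * V.realPeriodRat = plusPeriod f
      else (ϖ : ℝ) * V.imaginaryPeriodRat = minusPeriod f)
    (κ : ZpExtension ℚ p) (γ : absoluteGaloisGroup ℚ) (hκ : κ.IsCyclotomic)
    (hγ : κ.IsTopGenerator γ) (hγK : γ ∈ galRange (K := ℚ) K₀) (hvar : IsCyclotomicVariable p γ)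
    (hDp : Nonempty (EtaSignedSelmerDualData V κ K₀ ℚ_[p] η γ 1))
    (hDm : Nonempty (EtaSignedSelmerDualData V κ K₀ ℚ_[p] η γ (-1))) :
    (∀ (Lp : IwasawaAlgebra p), IsQuadraticBranchPlusLFunction f p ϖ Lp →
        ∀ D : EtaSignedSelmerDualData V κ K₀ ℚ_[p] η γ 1, D.charIdeal = Ideal.span {Lp}) ↔
      (∀ (Lm : IwasawaAlgebra p), IsQuadraticBranchMinusLFunction f p ϖ Lm →
        ∀ (L' : IwasawaAlgebra p), Lm = PowerSeries.X * L' →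
        ∀ D : EtaSignedSelmerDualData V κ K₀ ℚ_[p] η γ (-1), D.charIdeal = Ideal.span {L'}) := by
  have hμ := etaSignedMC_iff_muInvariant_eq_of_cm h26 h22 K₀ η hη hη1 V hp hCM hgood hap hf ϖ hϖ
    κ γ hκ hγ hγK hvar
  rw [hμ.1, hμ.2]
  exact evenEtaMuPart_iff_oddEtaMuPart_of_cm h26 h22 K₀ η hη hη1 V hp hCM hgood hap hf ϖ hϖ κ γ hκ
    hγ hγK hvar hDp hDm

/-! ## §4 (appended, proofs only; seat bsd-cm-k8i-ty g8) The `∀`-forms of §3 WITHOUT the displayed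
## non-emptiness hypotheses

§3's `evenEtaMuPart_iff_oddEtaMuPart_of_cm` and `etaEvenMC_iff_etaOddMC_of_cm` display
`Nonempty (EtaSignedSelmerDualData V κ K₀ ℚ_[p] η γ (±1))`. By the Literature existence theorem
`Kobayashi2003.nonempty_etaSignedSelmerDualData_cyclotomic` (`Kobayashi2003/EtaSignedSelmerDualExistsProofs.lean`,
this seat; Literature twin of the Summits `Additive.nonempty_etaSignedSelmerDualData_cyclotomic`)
both data types ARE inhabited for `K₀ = ℚ(μ_p)` and any topological generator `γ ∈ Gal(ℚ̄/K₀)` —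
exactly the frame's `hγ`, `hγK`. So the two equivalences hold outright, granted `h26` and `h22` only.
-/

/-- **The even `μ`-part (`∀ (Lp, D⁺)`, the shape of item 19865 `PlusMCEtaKMuPart`) iff the odd
`μ`-part (`∀ (Lm = X·L', D⁻)`)**, for a CM `V`, granted `h26` and `h22` ONLY — §3's
`evenEtaMuPart_iff_oddEtaMuPart_of_cm` with the non-emptiness of the data DISCHARGED by
`Kobayashi2003.nonempty_etaSignedSelmerDualData_cyclotomic`. The K8-inert route's odd-side readings
carry no second `μ`-residual. [cite: BurungaleTian2026, Thm. 2.6 and Rem. 2.7 (p. 5)]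
[cite: Kobayashi2003, §4 (p. 8), proof of Thm. 7.4 (p. 13), Def. 2.1 (p. 5)] [cite: Washington1997, §13.2] -/
theorem evenEtaMuPart_iff_oddEtaMuPart_of_cm'
    (h26 : thm26_etaKatoSequences_charIdeal_upToP_of_cm)
    (h22 : thm22_etaSignedSelmerDual_finite_torsion)
    (K₀ : Type) [Field K₀] [NumberField K₀] [IsCyclotomicExtension {p} ℚ K₀]
    [(galRange (K := ℚ) K₀).Normal] (η : absoluteGaloisGroup ℚ →* ℤˣ)
    (hη : ∀ σ ∈ galRange (K := ℚ) K₀, η σ = 1) (hη1 : η ≠ 1)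
    (V : WeierstrassCurve ℚ) [V.IsElliptic] [V.IsGloballyMinimal] {N : ℕ} [NeZero N]
    {f : CuspForm (Gamma0 N) 2} (hp : p ≠ 2) (hCM : V.HasCM) (hgood : V.HasGoodReductionAtPrime p)
    (hap : V.frobeniusTrace p = 0) (hf : IsNewformOf V f) (ϖ : ℚ)
    (hϖ : if Even (p / 2) then (ϖ : ℝ) * V.realPeriodRat = plusPeriod f
      else (ϖ : ℝ) * V.imaginaryPeriodRat = minusPeriod f)
    (κ : ZpExtension ℚ p) (γ : absoluteGaloisGroup ℚ) (hκ : κ.IsCyclotomic)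
    (hγ : κ.IsTopGenerator γ) (hγK : γ ∈ galRange (K := ℚ) K₀) (hvar : IsCyclotomicVariable p γ) :
    (∀ (Lp : IwasawaAlgebra p), IsQuadraticBranchPlusLFunction f p ϖ Lp →
        ∀ D : EtaSignedSelmerDualData V κ K₀ ℚ_[p] η γ 1,
          muInvariant p D.X = muInvariant p (IwasawaAlgebra p ⧸ Ideal.span {Lp})) ↔
      (∀ (Lm : IwasawaAlgebra p), IsQuadraticBranchMinusLFunction f p ϖ Lm →
        ∀ (L' : IwasawaAlgebra p), Lm = PowerSeries.X * L' →
        ∀ D : EtaSignedSelmerDualData V κ K₀ ℚ_[p] η γ (-1),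
          muInvariant p D.X = muInvariant p (IwasawaAlgebra p ⧸ Ideal.span {L'})) :=
  evenEtaMuPart_iff_oddEtaMuPart_of_cm h26 h22 K₀ η hη hη1 V hp hCM hgood hap hf ϖ hϖ κ γ hκ hγ hγK
    hvar (nonempty_etaSignedSelmerDualData_cyclotomic V κ K₀ ℚ_[p] η 1 hγ hγK)
    (nonempty_etaSignedSelmerDualData_cyclotomic V κ K₀ ℚ_[p] η (-1) hγ hγK)

/-- **[Kob03] Thm. 7.4 (ii) ⟺ (iii) at the quadratic `η` for a CM curve, `∀` forms, granted `h26`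
and `h22` ONLY** (§3's `etaEvenMC_iff_etaOddMC_of_cm` with the non-emptiness DISCHARGED): the even
main conjecture at `η` holds for every `(Lp, D⁺)` iff the odd one holds for every `(Lm = X·L', D⁻)`.
On CM curves the content of the named fact `Kobayashi2003.thm74_etaEvenMC_iff_etaOddMC` (all `V`
with `a_p = 0`) is thus implied by [BT26] Thm. 2.6 read at `η` together with [Kob03] Thm. 2.2 at
`η`. [cite: Kobayashi2003, Thm. 7.4 (p. 13), §4 (p. 8), Def. 2.1 (p. 5)] [cite: BurungaleTian2026, Thm. 2.6 (p. 5)] -/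
theorem etaEvenMC_iff_etaOddMC_of_cm'
    (h26 : thm26_etaKatoSequences_charIdeal_upToP_of_cm)
    (h22 : thm22_etaSignedSelmerDual_finite_torsion)
    (K₀ : Type) [Field K₀] [NumberField K₀] [IsCyclotomicExtension {p} ℚ K₀]
    [(galRange (K := ℚ) K₀).Normal] (η : absoluteGaloisGroup ℚ →* ℤˣ)
    (hη : ∀ σ ∈ galRange (K := ℚ) K₀, η σ = 1) (hη1 : η ≠ 1)
    (V : WeierstrassCurve ℚ) [V.IsElliptic] [V.IsGloballyMinimal] {N : ℕ} [NeZero N]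
    {f : CuspForm (Gamma0 N) 2} (hp : p ≠ 2) (hCM : V.HasCM) (hgood : V.HasGoodReductionAtPrime p)
    (hap : V.frobeniusTrace p = 0) (hf : IsNewformOf V f) (ϖ : ℚ)
    (hϖ : if Even (p / 2) then (ϖ : ℝ) * V.realPeriodRat = plusPeriod f
      else (ϖ : ℝ) * V.imaginaryPeriodRat = minusPeriod f)
    (κ : ZpExtension ℚ p) (γ : absoluteGaloisGroup ℚ) (hκ : κ.IsCyclotomic)
    (hγ : κ.IsTopGenerator γ) (hγK : γ ∈ galRange (K := ℚ) K₀) (hvar : IsCyclotomicVariable p γ) :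
    (∀ (Lp : IwasawaAlgebra p), IsQuadraticBranchPlusLFunction f p ϖ Lp →
        ∀ D : EtaSignedSelmerDualData V κ K₀ ℚ_[p] η γ 1, D.charIdeal = Ideal.span {Lp}) ↔
      (∀ (Lm : IwasawaAlgebra p), IsQuadraticBranchMinusLFunction f p ϖ Lm →
        ∀ (L' : IwasawaAlgebra p), Lm = PowerSeries.X * L' →
        ∀ D : EtaSignedSelmerDualData V κ K₀ ℚ_[p] η γ (-1), D.charIdeal = Ideal.span {L'}) :=
  etaEvenMC_iff_etaOddMC_of_cm h26 h22 K₀ η hη hη1 V hp hCM hgood hap hf ϖ hϖ κ γ hκ hγ hγK hvar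
    (nonempty_etaSignedSelmerDualData_cyclotomic V κ K₀ ℚ_[p] η 1 hγ hγK)
    (nonempty_etaSignedSelmerDualData_cyclotomic V κ K₀ ℚ_[p] η (-1) hγ hγK)

/-- **[Kob03] Thm. 7.4 (ii) ⟺ (iii) at `η` ON CM CURVES in the EXACT binder shape of the named fact
`Kobayashi2003.thm74_etaEvenMC_iff_etaOddMC` (odd side quantified `∀ Lm, ∀ D, ∀ L'`), with
`V.HasCM` added, from `h26` and `h22` only.** [cite: Kobayashi2003, Thm. 7.4 (p. 13), §4 (p. 8)]
[cite: BurungaleTian2026, Thm. 2.6 (p. 5)] -/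
theorem thm74_etaEvenMC_iff_etaOddMC_of_cm
    (h26 : thm26_etaKatoSequences_charIdeal_upToP_of_cm)
    (h22 : thm22_etaSignedSelmerDual_finite_torsion)
    (p : ℕ) [Fact p.Prime] (K₀ : Type) [Field K₀] [NumberField K₀] [IsCyclotomicExtension {p} ℚ K₀]
    [(galRange (K := ℚ) K₀).Normal] (η : absoluteGaloisGroup ℚ →* ℤˣ)
    (hη : ∀ σ ∈ galRange (K := ℚ) K₀, η σ = 1) (hη1 : η ≠ 1)
    (V : WeierstrassCurve ℚ) [V.IsElliptic] [V.IsGloballyMinimal] {N : ℕ} [NeZero N]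
    {f : CuspForm (Gamma0 N) 2} (hp : p ≠ 2) (hCM : V.HasCM) (hgood : V.HasGoodReductionAtPrime p)
    (hap : V.frobeniusTrace p = 0) (hf : IsNewformOf V f) (ϖ : ℚ)
    (hϖ : if Even (p / 2) then (ϖ : ℝ) * V.realPeriodRat = plusPeriod f
      else (ϖ : ℝ) * V.imaginaryPeriodRat = minusPeriod f)
    (κ : ZpExtension ℚ p) (γ : absoluteGaloisGroup ℚ) (hκ : κ.IsCyclotomic)
    (hγ : κ.IsTopGenerator γ) (hγK : γ ∈ galRange (K := ℚ) K₀) (hvar : IsCyclotomicVariable p γ) :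
    (∀ (Lp : IwasawaAlgebra p), IsQuadraticBranchPlusLFunction f p ϖ Lp →
        ∀ D : EtaSignedSelmerDualData V κ K₀ ℚ_[p] η γ 1, D.charIdeal = Ideal.span {Lp}) ↔
      (∀ (Lm : IwasawaAlgebra p), IsQuadraticBranchMinusLFunction f p ϖ Lm →
        ∀ (D : EtaSignedSelmerDualData V κ K₀ ℚ_[p] η γ (-1)) (L' : IwasawaAlgebra p),
          Lm = PowerSeries.X * L' → D.charIdeal = Ideal.span {L'}) := by
  rw [etaEvenMC_iff_etaOddMC_of_cm' h26 h22 K₀ η hη hη1 V hp hCM hgood hap hf ϖ hϖ κ γ hκ hγ hγK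
    hvar]
  exact ⟨fun h Lm hLm D L' hL' => h Lm hLm L' hL' D, fun h Lm hLm L' hL' D => h Lm hLm D L' hL'⟩

end Literature.NumberTheory.EllipticCurves.BurungaleTian2026

end
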